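import Literature.Analysis.FluidPDE.FluidComputer.ThresholdLevelTableA5
import HarnessLib

/-!
# Kernel run of the A = 5 level-table checker, chunks 12 … 15 (steps 300 … 399) (bp3 gen 13, layer 4)

HONEST FRAMING: low prior, high value-of-information experiment on Tao's machine paradigm; NOT a
claim that NS blows up.

Four kernel evaluations (`decide +kernel`; no `native_decide`, no extra axioms) of the checker
`runSteps` (`ThresholdLevelCheck.lean`) on 25 steps of `ThresholdLevelTableA5.stepsT` at a time, from
the entry box `Bc i` towards the next chunk's first level, returning the entry box `Bc (i+1)`
(≈ 30 s of kernel time per chunk; same scheme as `ThresholdLevelTableRun0 … 7` for A = 2).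
-/

namespace Literature.Analysis.FluidPDE.FluidComputer

namespace ThresholdLevelTableA5

set_option maxHeartbeats 10000000 in
set_option maxRecDepth 200000 in
/-- Chunk 12 of the A = 5 table run (steps 300 … 324). [folklore] -/
theorem run12 : runSteps 60 12 3 GIt RbIt Bc12 chunk12 609982525393787 = some Bc13 := by
  decide +kernel

set_option maxHeartbeats 10000000 in
set_option maxRecDepth 200000 in
/-- Chunk 13 of the A = 5 table run (steps 325 … 349). [folklore] -/
theorem run13 : runSteps 60 12 3 GIt RbIt Bc13 chunk13 667707705241608 = some Bc14 := by
  decide +kernel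

set_option maxHeartbeats 10000000 in
set_option maxRecDepth 200000 in
/-- Chunk 14 of the A = 5 table run (steps 350 … 374). [folklore] -/
theorem run14 : runSteps 60 12 3 GIt RbIt Bc14 chunk14 730895658611199 = some Bc15 := by
  decide +kernel

set_option maxHeartbeats 10000000 in
set_option maxRecDepth 200000 in
/-- Chunk 15 of the A = 5 table run (steps 375 … 399). [folklore] -/
theorem run15 : runSteps 60 12 3 GIt RbIt Bc15 chunk15 800063350449725 = some Bc16 := by
  decide +kernel

end ThresholdLevelTableA5

end Literature.Analysis.FluidPDE.FluidComputer
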